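import Summits.CriticalPhenomena.PercolationContinuityZ3.Theorems.Transplant.SkelNegBChoiceAllT
import Summits.CriticalPhenomena.PercolationContinuityZ3.Theorems.Transplant.SkelNeg1ChoiceO
import HarnessLib

/-!
# N1 (the `{±1}` node), (C) column (C-A8 glue): **`ReachHoldsRHNOFn` OF THE CHOICE FUNCTION OF RECORD `negChoiceAllOT` FROM THE PER-POINT
# CORRIDOR RESIDUE** — `PlanarSkeletonNeg.reachHoldsRHNOFn_negChoiceAllOT_of`: if at every `(κ, G, Φ, t, p, hC, O, q)` with
# `(NegB.choiceAtOT …).AtQO O q` (one vertex type, `0 < p < 1`) the residue `Skel.ReachOblRHN G Skel.nmaxN ((choiceAtOT …).scheme O q)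
# ((choiceAtOT …).FD O q) Φ.Δ κ.δ` holds, then `ReachHoldsRHNOFn (negChoiceAllOT gv fv Pv Sv)` — the (C) hypothesis of
# `samePDropOfSkeletonNeg₁_of_choiceFnNO`. Pure glue (`negChoiceAllOT_eq`), plus **`NegB.choiceAtOT_scheme_eq`**: the scheme and face data of
# record are LITERALLY `⟨cellGeomSG₂b G F P t (concRadii2N P gap (fun _ => 0) E₀ L′ off) b₀, q, κ.δ⟩` / `faceDataSG G F P t (concRadii2N …)` with
# `F := NegB.fineO …`, `P := NegB.fcells …`, `gap/E₀/L′ := Skelφ.Prm.gap/E₀/Lp (Sv … q)`, `off := NegB.offN …`, `b₀ := NegB.b0T …` — the shape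
# `Skelφ.reachOblRHN_negSG₂b_of_floors` (SkelPhiNegReachFinal, (C-S11)) concludes (`Skel.nmaxN = 2000`), so the instantiation is ONE `exact`.

builds on p205010 (kernel theorem, internal audit signed; external expert review pending) — nothing in this file uses p205010; NOTHING is claimed about the
open node `SamePDropOfSkeletonNeg`.
Lane `prim-bschramm`, seat `prim-bschramm-p5` (gen 9; (C) lineage); helper file (`--supports stmt-CriticalPhenomena-4575 --as helper`).
[cite: KozmaNitzan2024, §4 Theorem 6 (pp. 25–31), Lemma 12 (pp. 23–25)] [folklore]
-/

noncomputable section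

open scoped Classical

namespace Summit.CriticalPhenomena.PercolationContinuityZ3.Theorems.Transplant

namespace PlanarSkeletonNeg

open SkelConc (Consts)
open Skelφ.StepI (OutO)
open Literature.Probability.Percolation

/-- **`ReachHoldsRHNOFn (negChoiceAllOT …)` from the per-point corridor residue at `AtQO`.** [folklore] -/
theorem reachHoldsRHNOFn_negChoiceAllOT_of (gv fv : Neg.FSlot) (Pv : NegB.PSlot) (Sv : NegB.SSlot)
    (h : ∀ (κ : Consts) {V : Type} [DecidableEq V] [Countable V] (G : SimpleGraph V) [G.LocallyFinite] (Φ : PlanarSkeletonNeg G) (t : V) (p : unitInterval)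
      (hC : Φ.CylSubcritical p) (O : OutO V) (q : unitInterval), (NegB.choiceAtOT κ Φ t p gv fv Sv hC Pv).AtQO O q → Φ.types = {t} → 0 < (p : ℝ) → (p : ℝ) < 1 →
      Skel.ReachOblRHN G Skel.nmaxN ((NegB.choiceAtOT κ Φ t p gv fv Sv hC Pv).scheme O q) ((NegB.choiceAtOT κ Φ t p gv fv Sv hC Pv).FD O q) Φ.Δ κ.δ) :
    ReachHoldsRHNOFn (negChoiceAllOT gv fv Pv Sv) := by
  intro κ V _ _ G _ Φ hg t ht h1 p hp0 hp1 hC O q hAt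
  rw [negChoiceAllOT_eq] at hAt ⊢
  exact h κ G Φ t p hC O q hAt h1 hp0 hp1

/-- **The scheme and face data of record, by name**: the shape `Skelφ.reachOblRHN_negSG₂b_of_floors` concludes (`Skel.nmaxN = 2000`). [folklore] -/
theorem NegB.choiceAtOT_reach_iff (κ : Consts) {V : Type} [DecidableEq V] [Countable V] {G : SimpleGraph V} [G.LocallyFinite] (Φ : PlanarSkeletonNeg G) (t : V)
    (p : unitInterval) (gv fv : Neg.FSlot) (Sv : NegB.SSlot) (hC : Φ.CylSubcritical p) (Pv : NegB.PSlot) (O : OutO V) (q : unitInterval) {Δ : ℕ} {δ : ℝ} :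
    Skel.ReachOblRHN G Skel.nmaxN ((NegB.choiceAtOT κ Φ t p gv fv Sv hC Pv).scheme O q) ((NegB.choiceAtOT κ Φ t p gv fv Sv hC Pv).FD O q) Δ δ ↔
      Skel.ReachOblRHN G 2000
        (⟨Skelφ.cellGeomSG₂b G (NegB.fineO κ Φ t p O.D O.DT O.ori (NegB.gOf κ Φ t p O gv) (NegB.fOf κ Φ t p O fv))
            (NegB.fcells κ Φ t p O.merged (NegB.gOf κ Φ t p O gv) (NegB.fOf κ Φ t p O fv)) t
            (Skelφ.concRadii2N (NegB.fcells κ Φ t p O.merged (NegB.gOf κ Φ t p O gv) (NegB.fOf κ Φ t p O fv))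
              (Skelφ.Prm.gap (Sv κ Φ t p O.merged (NegB.gOf κ Φ t p O gv) (NegB.fOf κ Φ t p O fv) q)) (fun _ => 0)
              (Skelφ.Prm.E₀ (Sv κ Φ t p O.merged (NegB.gOf κ Φ t p O gv) (NegB.fOf κ Φ t p O fv) q))
              (Skelφ.Prm.Lp (Sv κ Φ t p O.merged (NegB.gOf κ Φ t p O gv) (NegB.fOf κ Φ t p O fv) q))
              (NegB.offN κ Φ t p O.merged (NegB.gOf κ Φ t p O gv) (NegB.fOf κ Φ t p O fv)))
            (NegB.b0T κ Φ t p O.merged (NegB.gOf κ Φ t p O gv) (NegB.fOf κ Φ t p O fv)), q, κ.δ⟩ : KNCells.KSchA V ℕ)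
        (Skelφ.faceDataSG G (NegB.fineO κ Φ t p O.D O.DT O.ori (NegB.gOf κ Φ t p O gv) (NegB.fOf κ Φ t p O fv))
          (NegB.fcells κ Φ t p O.merged (NegB.gOf κ Φ t p O gv) (NegB.fOf κ Φ t p O fv)) t
          (Skelφ.concRadii2N (NegB.fcells κ Φ t p O.merged (NegB.gOf κ Φ t p O gv) (NegB.fOf κ Φ t p O fv))
            (Skelφ.Prm.gap (Sv κ Φ t p O.merged (NegB.gOf κ Φ t p O gv) (NegB.fOf κ Φ t p O fv) q)) (fun _ => 0)
            (Skelφ.Prm.E₀ (Sv κ Φ t p O.merged (NegB.gOf κ Φ t p O gv) (NegB.fOf κ Φ t p O fv) q))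
            (Skelφ.Prm.Lp (Sv κ Φ t p O.merged (NegB.gOf κ Φ t p O gv) (NegB.fOf κ Φ t p O fv) q))
            (NegB.offN κ Φ t p O.merged (NegB.gOf κ Φ t p O gv) (NegB.fOf κ Φ t p O fv))))
        Δ δ :=
  Iff.rfl

end PlanarSkeletonNeg

end Summit.CriticalPhenomena.PercolationContinuityZ3.Theorems.Transplant

end
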